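import Literature.AlgebraicGeometry.Resolution.PointBlowupFlagInvariant

/-!
# Hauser–Wagner 2014: the adjusted height vector of a purely inseparable surface drops under every
  point blow-up (named fact, dimension 2, characteristic `p`)

H. Hauser, D. Wagner, *Alternative invariants for the embedded resolution of purely inseparable surface
singularities*, L'Enseignement Math. (2) **60** (2014) 177–224 [cite: HauserWagner2014] (pages read on the
published PDF; = arXiv:1403.6789).  For a purely inseparable surface `G = x^p + F(y,z)` of order `p` over an
algebraically closed field `K` of characteristic `p > 0` they attach to the class `f` of `F` in `R/R^p`, a
closed point `a` and a local flag `𝓕` the ADJUSTED HEIGHT VECTOR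
`i_a(f, 𝓕) = (intricacy_a(f), slope_a(f))` (§4, pp. 187–192):

* `intricacy_a(f) = height_a(f) − bonus_a(f) = min {height(F) − bonus(F) ; (y,z) ∈ 𝒞_𝓕}` (p. 191 l. 30–31,
  l. 42 – p. 192 l. 1), `height(F) = deg_y(F) − ord_y(F)` (p. 190 l. 2–3), `bonus(F) = 1 + δ | ε | 0` for `F`
  adjacent | close | distant, `0 < ε < δ < 1` (p. 190 l. 32–41);
* "`slope_a(f) = max {slope(F) ; (y,z) ∈ 𝒞 with height(F) = height_a(f)}`" (p. 192 l. 7–8), where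
  "`slope(F) = α₁/(α₁ − α₂) · (β₂ − β₁)`, … `(α₁,β₁)` and `(α₂,β₂)` denote those elements of `A` whose first
  components have the highest respectively second highest value among all vertices of `A`", `slope(F) = ∞` if
  the Newton polygon is a quadrant (p. 190 l. 19–27);
* "We consider this pair with respect to the lexicographic order with `(0,1) < (1,0)`" (p. 192 l. 12–17);

and prove (Theorem 1 p. 186 l. 24–37 = Theorem 2 p. 196 l. 2–18):

> **Theorem 2 (i).** Let `F` be a polynomial in two variables `y, z` over an algebraically closed field of
> characteristic `p > 0`.  Denote by `f` the residue class of `F` modulo `p`-th powers and assume that `f` is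
> not a quasi-monomial at a given closed point `a` of `𝔸²`.  Fix a local flag `𝓕` in `𝔸²` at `a`.  Let
> `π : 𝔸̃² → 𝔸²` be the point blowup with center `a` and exceptional divisor `E = π⁻¹(a)`.  For any closed
> point `a'` in `E`, denoting by `f'` and `𝓕'` the transforms of `f` and `𝓕` in `𝔸̃²`, the adjusted height
> vector `i_a(f, 𝓕)` of `f` at `a` with respect to `𝓕` satisfies `i_{a'}(f', 𝓕') < i_a(f, 𝓕)`.

(Theorem 1: "`G(x,y,z) = x^p + F(y,z)` where `F` is a polynomial of order `≥ p` at `0` … (i) There exists a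
local invariant `i_a(f)` such that for any closed point `a'` in `E` one has `i_{a'}(f') < i_a(f)`".)

## What this file adds to the tree's transcription (`PointBlowupHeight`)

`Literature.AlgebraicGeometry.Resolution.PointBlowupHeight` already types, over the atlas model
(`PointBlowup.State`, `PointBlowup.step`), every measure of §4 / §6.1 / §9.1 of an expansion in GIVEN
coordinates, the three moves (T) `F(yz + tz, z)`, (H) `F(yz, z)`, (V) `F(y, yz)` of §5 (p. 197 l. 28–30) as
`HauserWagner2014.moveT` / `moveV`, and the coordinate-free FIRST component `HauserWagner2014.intricacyAt`
(via `maxOrdFree`, the maximum of `ord_y` over subordinate changes).  It records that "the coordinate-free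
slope … is NOT typed" there.  Here we type the missing second component and the theorem:

* `HauserWagner2014.slopePS` — `slope` of an expansion given as a formal POWER SERIES (the expansion in
  changed subordinate coordinates is a series), computed from its support exactly as printed: `α₁` times the
  least reciprocal steepness `(β − β₁)/(α₁ − α)` over the support points `(α, β)` with `α < α₁`, fibre by fibre
  in `α` (within a fibre the least `β` is the only candidate); `⊤` for a quadrant;
* `HauserWagner2014.slopeValues` — the set `{slope(F) ; (y,z) ∈ 𝒞_𝓕 with height(F) = height_a(f)}` read on
  the triangular subordinate changes `y ↦ y + φ(z)`, `φ(0) = 0`, followed by the deletion of the `p`-th power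
  monomials (the class in `R/R^p`, p. 187 l. 36 – p. 188 l. 1): `cleanSeries p (substFree rig free φ F)` with
  the tree's `HauserWagner2014.substFree` and `HauserPerlega2024.cleanSeries`; "realising the height" is the
  tree's `OrdFreeAtLeast p rig free φ (maxOrdFree p F rig free) F`;
* `HauserWagner2014.IsSlopeAt` — "`slope_a(f) = max {…}`": `v` is the GREATEST element of `slopeValues`
  (the printed definition is a maximum; its existence is part of that definition and is not asserted here —
  the same convention as `HauserPerlega2024.IsFlagInvariant`);
* `HauserWagner2014.IsAdjustedHeightVectorAt` — `v = (intricacy_a(f), slope_a(f)) ∈ ℚ ×ₗ WithTop ℚ`;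
* the NAMED FACT `HauserWagner2014` = Theorem 2 (i), together with the first-component inequalities of
  Proposition 1 (p. 199 l. 39 – p. 200 l. 8: `intricacy(f*) ≤ intricacy(f)` at every point, `<` under move (V)),
  in the model, NOT proved here (one future discharge `HauserWagner2014_holds`); the tree's earlier first-component
  reading `HauserWagner2014.IntricacyNonincreaseStatement` follows from it (`intricacyNonincreaseStatement_of`).

## Dictionary (model ↔ print) and the hypotheses as typed

* `K` algebraically closed of characteristic `p` prime (Thm 2 (i)); `s.F` is the expansion `F` WITHOUT `p`-th
  power monomials (`deletePthPowers p s.F = s.F`, "their representatives `F` … without any `p`-th power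
  monomials", p. 187 l. 40 – p. 188 l. 1), non-zero, of order `≥ p` (Theorem 1: "`F` is a polynomial of order
  `≥ p` at `0`", p. 186 l. 27 — this is what makes the division by the `p`-th power of the chart variable in
  `PointBlowup.step` the transform `G' = x^p + y^{−p}F(y,yz)` of Remark 9, p. 197 l. 7–14; by Remark 8,
  p. 196 l. 19–29, the displacement between total, strict and this transform does not affect the theorem);
* the flag `𝓕` at `a` is the coordinate line of the RIGID letter `rig` (`z = 0`), the free letter is `y`
  (any regular `h ∈ R̂_a` is a coordinate); subordinate changes "`(y,z) ↦ (y + v(y,z), z·u(y,z))` with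
  `∂_y v(y,0) ≠ −1`, `u(0,0) ≠ 0`" (p. 188 l. 7–10) are read through the triangular ones `y ↦ y + φ(z)`: for a
  subordinate `ψ`, `S_ψ⁻¹(y) = e·(y + φ(z))` with `e` a unit (Weierstrass), so `S_ψ = S_μ ∘ S_τ` with `τ`
  triangular and `μ` a rescaling of both letters by units, and such rescalings fix the Newton polygon of the
  class (its vertices lie off `p·ℕ²`) — hence `max ord_y`, `height`, `slope`, `width` over `𝒞_𝓕` are the
  same as over triangular changes (cf. §6.2, p. 206 l. 32–35: "One can assume that `φ'` is of the form
  `(y,z) ↦ (y + A(z), z)`"; and p. 191 l. 24–27: the highest vertex `(α₁, β₁)` and `deg_y` do not depend on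
  the subordinate coordinates);
* the closed points `a'` of `E ≅ ℙ¹_K` are: the point `t ∈ K` of the free axis in the chart of the rigid
  letter — `moveT p rig free t s` (`t ≠ 0`: translational, `t = 0`: horizontal) — and the origin of the chart
  of the free letter — `moveV p free s` (vertical) (p. 197 l. 20–30); the induced flag `𝓕'` (p. 195 l. 24–32)
  is `z = 0` again in all three cases, so `(rig, free)` is transported unchanged (as in `PointBlowupHeight`);
* the given presentation `s.F` REALISES the height (`Realizes`, "Fix subordinate coordinates … realizing the
  height of `f`", p. 197 l. 15–19; every class has one, and the set of points `a'` does not depend on the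
  presentation), and in it `F` "is not a quasi-monomial" (`width(F) = 1 ∧ ord_y(F) = 0`, p. 190 l. 14–15; the
  exception of Thm 2 (i), used through the realising expansion on p. 205 l. 13–15) and "not a monomial":
  `0 < height(F)` ("Since `F` is not a monomial we know that `height(F) > 0`", p. 205 l. 10; the theorem is
  the induction step "as long as … `f` … is not a monomial", §7 p. 207 l. 16–26, which runs until
  `height_a(f) = 0`) — an explicit standing assumption of §§5–7 added to the hypotheses of Thm 2 (i), which
  weakens, never strengthens, the typed statement;
* HW's exceptional monomials stay inside `F` (no boundary bookkeeping), so the multiplicity vector `s.r` of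
  the atlas state is irrelevant and arbitrary.

NOT typed here: Theorem 1 (ii) / Theorem 2 (ii) (finitely many point blow-ups monomialise `f` or drop the
order), Corollaries 1–2 (embedded resolution of purely inseparable surfaces of order `≤ p`; the scheme-level
content is in the tree as `CossartJannsenSaito2020` / `CossartPiltant2019`), §9's second invariant `j_a(f)`
(its decrease, §9.2–9.3, is only sketched in print), §10 Prop. 6.  Statement only (D-0026: exactly one new
named fact, `HauserWagner2014`; every other declaration is a definition with a body or a proved lemma).
-/

noncomputable section

open MvPolynomial Finset

namespace Literature.AlgebraicGeometry.Resolution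

open Literature.AlgebraicGeometry.Resolution.Hauser2010
open Literature.AlgebraicGeometry.Resolution.PointBlowup
open Literature.AlgebraicGeometry.Resolution.HauserPerlega2024 (ordAlong cleanSeries)

namespace HauserWagner2014

variable {σ : Type*} {K : Type*} [Field K]

/-! ### §4 — the measures of an expansion given as a formal power series -/

/-- `ord_{y_i}` of a power-series expansion: the least exponent of `y_i` in its support, as a natural number
(`0` for the zero series; the tree's `HauserPerlega2024.ordAlong` made finite). [cite: HauserWagner2014, §4 p. 189 l. 5–9 (ord_y)] -/
def ordVarPS (H : MvPowerSeries σ K) (i : σ) : ℕ := (ordAlong i H).toNat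

/-- `deg_y` of a power-series expansion: the free exponent `α₁` of the highest vertex `(α₁, β₁)` of the Newton polygon,
i.e. the least free exponent on the lowest rigid face `β = β₁ = ord_z` ("the vertex of `N` whose first component has
the largest value among all vertices of `A`"). [cite: HauserWagner2014, §4 p. 189 l. 10–13 and Remark 1] -/
def degAlongPS (H : MvPowerSeries σ K) (rig free : σ) : ℕ :=
  (⨅ (d : σ →₀ ℕ) (_ : H d ≠ 0 ∧ d rig = ordVarPS H rig), ((d free : ℕ) : ℕ∞)).toNat

/-- "`height(F) = deg_y(F) − ord_y(F)`" for a power-series expansion. [cite: HauserWagner2014, §4 p. 190 l. 2–3] -/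
def heightPS (H : MvPowerSeries σ K) (rig free : σ) : ℕ := degAlongPS H rig free - ordVarPS H free

/-- for a free exponent `a`, the least rigid exponent `β` among the support points `(a, β)` of the expansion (`⊤` if the
fibre is empty): the only candidate of the fibre for the second highest vertex. [cite: HauserWagner2014, §4 p. 190 l. 19–27 (slope)] -/
def fiberMinPS (H : MvPowerSeries σ K) (rig free : σ) (a : ℕ) : ℕ∞ :=
  ⨅ (d : σ →₀ ℕ) (_ : H d ≠ 0 ∧ d free = a), ((d rig : ℕ) : ℕ∞)

/-- the contribution of the fibre `α = a < α₁` to the slope: `α₁ · (β − β₁)/(α₁ − a)` for its least `β` (`⊤` for an empty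
fibre); the minimum over `a` is attained at the second highest vertex `(α₂, β₂)`. [cite: HauserWagner2014, §4 p. 190 l. 19–27 (slope)] -/
def fiberSlopePS (H : MvPowerSeries σ K) (rig free : σ) (a : ℕ) : WithTop ℚ :=
  if fiberMinPS H rig free a = ⊤ then ⊤
  else (((degAlongPS H rig free : ℚ) * ((((fiberMinPS H rig free a).toNat : ℕ) : ℚ) - (ordVarPS H rig : ℚ)) /
      ((degAlongPS H rig free : ℚ) - (a : ℚ)) : ℚ) : WithTop ℚ)

/-- "`slope(F) = α₁/(α₁ − α₂) · (β₂ − β₁)`, where `(α₁,β₁)` and `(α₂,β₂)` denote those elements of `A` whose first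
components have the highest respectively second highest value among all vertices of `A`" — equivalently `α₁` times the
least reciprocal steepness `(β − β₁)/(α₁ − α)` over the support points with `α < α₁` — for a power-series expansion;
"If `N` is a quadrant, we set … `slope(F) = ∞`" (`⊤`).  On a polynomial this is the tree's `HauserWagner2014.slope`
read fibre by fibre. [cite: HauserWagner2014, §4 p. 190 l. 19–27] -/
def slopePS (H : MvPowerSeries σ K) (rig free : σ) : WithTop ℚ :=
  (Finset.range (degAlongPS H rig free)).inf fun a => fiberSlopePS H rig free a

/-- "`width(F) = deg_z(F) − ord_z(F)`" for a power-series expansion (the height with the letters exchanged).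
[cite: HauserWagner2014, §4 p. 190 l. 12–14] -/
def widthPS (H : MvPowerSeries σ K) (rig free : σ) : ℕ := degAlongPS H free rig - ordVarPS H rig

/-! ### §4 — the coordinate-free slope and the adjusted height vector `i_a(f, 𝓕)` -/

variable [DecidableEq σ]

/-- the expansion of the class of `F` in the subordinate coordinates `y_free ↦ y_free + φ(y_rig)` (`φ(0) = 0`): the
substituted series with its `p`-th power monomials deleted ("their representatives `F` as expansions `F(y,z)` in `K[[y,z]]`
without any `p`-th power monomials"). [cite: HauserWagner2014, §4 p. 187 l. 36 – p. 188 l. 10] -/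
def expansionPS (p : ℕ) (rig free : σ) (φ : PowerSeries K) (F : MvPolynomial σ K) : MvPowerSeries σ K :=
  cleanSeries p (substFree rig free φ F)

/-- the set "`{slope(F) ; (y,z) ∈ 𝒞 with height(F) = height_a(f)}`": the slopes of the expansions of the class of `F` in
the subordinate coordinates (triangular presentation `y ↦ y + φ(z)`, `φ(0) = 0`) that REALISE the height, i.e. whose
`ord_y` is the maximal one `maxOrdFree`. [cite: HauserWagner2014, §4 p. 192 l. 7–8] -/
def slopeValues (p : ℕ) (F : MvPolynomial σ K) (rig free : σ) : Set (WithTop ℚ) :=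
  {v | ∃ φ : PowerSeries K, PowerSeries.constantCoeff φ = 0 ∧
    OrdFreeAtLeast p rig free φ (maxOrdFree p F rig free) F ∧ v = slopePS (expansionPS p rig free φ F) rig free}

/-- "`slope_a(f) = max {slope(F) ; (y,z) ∈ 𝒞 with height(F) = height_a(f)}`": `v` IS the slope of the class of `F` at the
point with respect to the flag `y_rig = 0` — the greatest element of `slopeValues` (the printed definition is a maximum;
its existence is part of that definition and is not asserted here). [cite: HauserWagner2014, §4 p. 192 l. 7–11] -/
def IsSlopeAt (p : ℕ) (F : MvPolynomial σ K) (rig free : σ) (v : WithTop ℚ) : Prop :=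
  IsGreatest (slopeValues p F rig free) v

/-- "`i_a(f) = (intricacy_a(f), slope_a(f))` … with respect to the lexicographic order with `(0,1) < (1,0)` … the
adjusted height vector invariant of `f` at `a`" (w.r.t. the flag `y_rig = 0`): `v` IS that vector — its first component
is the tree's coordinate-free `intricacyAt`, its second IS the slope. [cite: HauserWagner2014, §4 p. 192 l. 12–17] -/
def IsAdjustedHeightVectorAt (ε δ : ℚ) (p : ℕ) (F : MvPolynomial σ K) (rig free : σ) (v : ℚ ×ₗ WithTop ℚ) :
    Prop :=
  (ofLex v).1 = intricacyAt ε δ p F rig free ∧ IsSlopeAt p F rig free (ofLex v).2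

/-! ### Sanity lemmas -/

omit [DecidableEq σ] in
/-- an empty fibre contributes `⊤` to the slope. [cite: HauserWagner2014, §4 p. 190 l. 19 (slope = ∞ for a quadrant)] -/
theorem fiberSlopePS_of_eq_top {H : MvPowerSeries σ K} {rig free : σ} {a : ℕ}
    (h : fiberMinPS H rig free a = ⊤) : fiberSlopePS H rig free a = ⊤ := by
  unfold fiberSlopePS
  rw [if_pos h]

omit [DecidableEq σ] in
/-- "If `N` is a quadrant, we set the slope of `F` equal to `slope(F) = ∞`": no support point strictly left of the highest
vertex gives `slope = ⊤`. [cite: HauserWagner2014, §4 p. 190 l. 19] -/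
theorem slopePS_eq_top {H : MvPowerSeries σ K} {rig free : σ}
    (h : ∀ a < degAlongPS H rig free, fiberMinPS H rig free a = ⊤) : slopePS H rig free = ⊤ := by
  unfold slopePS
  exact (Finset.inf_eq_top_iff _ _).mpr fun a ha => fiberSlopePS_of_eq_top (h a (Finset.mem_range.mp ha))

/-- the first component of the adjusted height vector is the coordinate-free intricacy. [cite: HauserWagner2014, §4 p. 192 l. 12–14] -/
theorem IsAdjustedHeightVectorAt.fst_eq {ε δ : ℚ} {p : ℕ} {F : MvPolynomial σ K} {rig free : σ}
    {v : ℚ ×ₗ WithTop ℚ} (h : IsAdjustedHeightVectorAt ε δ p F rig free v) :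
    (ofLex v).1 = intricacyAt ε δ p F rig free := h.1

/-- the second component of the adjusted height vector is a realised slope (the maximum is attained).
[cite: HauserWagner2014, §4 p. 192 l. 7–8] -/
theorem IsAdjustedHeightVectorAt.snd_mem {ε δ : ℚ} {p : ℕ} {F : MvPolynomial σ K} {rig free : σ}
    {v : ℚ ×ₗ WithTop ℚ} (h : IsAdjustedHeightVectorAt ε δ p F rig free v) :
    (ofLex v).2 ∈ slopeValues p F rig free := h.2.1

/-- in a presentation that REALISES the height the coordinate-free intricacy is the intricacy of the given expansion
("`bonus(F)` takes the same value, `bonus_a(f)`, for all coordinates realizing `height_a(f)`, because `ord_y(F)` does").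
[cite: HauserWagner2014, §4 p. 191 l. 40 – p. 192 l. 1] -/
theorem intricacyAt_eq_intricacy_of_realizes {ε δ : ℚ} {p : ℕ} {F : MvPolynomial σ K} {rig free : σ}
    (h : Realizes p F rig free) : intricacyAt ε δ p F rig free = intricacy ε δ F rig free := by
  unfold Realizes at h
  unfold intricacyAt heightAt adjacencyAt intricacy height bonus adjacency
  rw [h]

/-- in a realising presentation the first component of the adjusted height vector is the intricacy of the GIVEN
expansion (the quantity the atlas evaluates, `HauserWagner2014.heightVector`'s first entry).
[cite: HauserWagner2014, §4 p. 191 l. 40 – p. 192 l. 1] -/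
theorem IsAdjustedHeightVectorAt.fst_eq_intricacy {ε δ : ℚ} {p : ℕ} {F : MvPolynomial σ K} {rig free : σ}
    {v : ℚ ×ₗ WithTop ℚ} (h : IsAdjustedHeightVectorAt ε δ p F rig free v) (hr : Realizes p F rig free) :
    (ofLex v).1 = intricacy ε δ F rig free := by
  rw [h.fst_eq, intricacyAt_eq_intricacy_of_realizes hr]

end HauserWagner2014

/-! ### The named fact -/

/-- **Hauser–Wagner 2014, Theorem 2 (i) (= Theorem 1 (i)) with Proposition 1: the adjusted height vector drops
under every point blow-up.**  "Let `F` be a polynomial in two variables `y, z` over an algebraically closed field of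
characteristic `p > 0`.  Denote by `f` the residue class of `F` modulo `p`-th powers and assume that `f` is not a
quasi-monomial at a given closed point `a` of `𝔸²`.  Fix a local flag `𝓕` in `𝔸²` at `a`.  Let `π : 𝔸̃² → 𝔸²` be
the point blowup with center `a` and exceptional divisor `E = π⁻¹(a)`.  For any closed point `a'` in `E`, denoting
by `f'` and `𝓕'` the transforms of `f` and `𝓕` in `𝔸̃²`, the adjusted height vector `i_a(f, 𝓕)` of `f` at `a`
with respect to `𝓕` satisfies `i_{a'}(f', 𝓕') < i_a(f, 𝓕)`" (Thm. 2 (i)); and, for its first component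
(Prop. 1): "Let `F ∈ K[[y,z]]` be the expansion of `f` with respect to subordinate coordinates `(y,z) ∈ 𝒞_𝓕`
realizing the height of `f`.  Furthermore let `F*(y,z)` be one of the transformations `F*(y,z) = F(yz + tz, z)`,
with `t ∈ K`, or `F*(y,z) = F(y, yz)` and let `f*` be the corresponding element in `R'/R'^p`.  Then
`intricacy(f*) ≤ intricacy(f)`.  Moreover, if … the blowup … is given by move (V), then
`intricacy(f*) < intricacy(f)`" — in the atlas model (module docstring: dictionary): for `p` prime, `K`
algebraically closed of characteristic `p`, `0 < ε < δ < 1`, a state `s` whose `F` is a non-zero cleaned expansion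
of order `≥ p` (Theorem 1: "`F` is a polynomial of order `≥ p`") in coordinates subordinate to the flag `y_rig = 0`
that realise the height, not a quasi-monomial and not a monomial (`0 < height`, the standing assumption of §§5–7,
p. 205 l. 10, p. 207 l. 16–26): (1) at every point `t` of the free axis in the chart of the rigid letter (moves
(T), (H)) the coordinate-free intricacy w.r.t. the induced flag does not exceed the one at `a`, and at the origin of
the chart of the free letter (move (V)) it is smaller; (2) if `v = i_a(f, 𝓕)`, then at each of these points — all
closed points of `E` — the adjusted height vector `v'` there satisfies `v' < v` lexicographically.  Dimension 2 and
purely inseparable order `p` only.  NAMED FACT, not proved here.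
[cite: HauserWagner2014, Thm. 2 (i) p. 196 l. 2–9; Prop. 1 p. 199 l. 39 – p. 200 l. 8; Thm. 1 (i) p. 186 l. 24–35; §4 p. 192 l. 7–17; §5 p. 197 l. 15–30] -/
def HauserWagner2014 : Prop :=
  ∀ (p : ℕ), p.Prime → ∀ (K : Type) [Field K] [CharP K p] [IsAlgClosed K] [DecidableEq K] (ε δ : ℚ)
    (s : PointBlowup.State (Fin 2) K) (rig free : Fin 2),
    HauserWagner2014.AdmissibleParams ε δ → rig ≠ free →
    s.F ≠ 0 → deletePthPowers p s.F = s.F → (p : ℕ∞) ≤ ordZero s.F →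
    HauserWagner2014.Realizes p s.F rig free → ¬ HauserWagner2014.IsQuasiMonomial s.F rig free →
    0 < HauserWagner2014.height s.F rig free →
      ((∀ t : K, HauserWagner2014.intricacyAt ε δ p (HauserWagner2014.moveT p rig free t s).F rig free ≤
            HauserWagner2014.intricacyAt ε δ p s.F rig free) ∧
        HauserWagner2014.intricacyAt ε δ p (HauserWagner2014.moveV p free s).F rig free <
          HauserWagner2014.intricacyAt ε δ p s.F rig free) ∧
      ∀ v : ℚ ×ₗ WithTop ℚ, HauserWagner2014.IsAdjustedHeightVectorAt ε δ p s.F rig free v →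
        (∀ (t : K) (v' : ℚ ×ₗ WithTop ℚ),
          HauserWagner2014.IsAdjustedHeightVectorAt ε δ p (HauserWagner2014.moveT p rig free t s).F rig free v' →
            v' < v) ∧
        ∀ v' : ℚ ×ₗ WithTop ℚ,
          HauserWagner2014.IsAdjustedHeightVectorAt ε δ p (HauserWagner2014.moveV p free s).F rig free v' → v' < v

namespace HauserWagner2014

variable {p : ℕ} {K : Type} [Field K] [CharP K p] [IsAlgClosed K] [DecidableEq K] {ε δ : ℚ}
  {s : PointBlowup.State (Fin 2) K} {rig free : Fin 2}

/-- Unfolding the named fact at one state: the (T)/(H) clause of Theorem 2 (i). [cite: HauserWagner2014, Thm. 2 (i) p. 196 l. 2–9] -/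
theorem moveT_lt (h : HauserWagner2014) (hp : p.Prime) (hεδ : AdmissibleParams ε δ) (hrf : rig ≠ free)
    (hF : s.F ≠ 0) (hclean : deletePthPowers p s.F = s.F) (hord : (p : ℕ∞) ≤ ordZero s.F)
    (hreal : Realizes p s.F rig free) (hqm : ¬ IsQuasiMonomial s.F rig free) (hmon : 0 < height s.F rig free)
    {v : ℚ ×ₗ WithTop ℚ} (hv : IsAdjustedHeightVectorAt ε δ p s.F rig free v) (t : K) {v' : ℚ ×ₗ WithTop ℚ}
    (hv' : IsAdjustedHeightVectorAt ε δ p (moveT p rig free t s).F rig free v') : v' < v :=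
  ((h p hp K ε δ s rig free hεδ hrf hF hclean hord hreal hqm hmon).2 v hv).1 t v' hv'

/-- Unfolding the named fact at one state: the (V) clause of Theorem 2 (i). [cite: HauserWagner2014, Thm. 2 (i) p. 196 l. 2–9] -/
theorem moveV_lt (h : HauserWagner2014) (hp : p.Prime) (hεδ : AdmissibleParams ε δ) (hrf : rig ≠ free)
    (hF : s.F ≠ 0) (hclean : deletePthPowers p s.F = s.F) (hord : (p : ℕ∞) ≤ ordZero s.F)
    (hreal : Realizes p s.F rig free) (hqm : ¬ IsQuasiMonomial s.F rig free) (hmon : 0 < height s.F rig free)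
    {v : ℚ ×ₗ WithTop ℚ} (hv : IsAdjustedHeightVectorAt ε δ p s.F rig free v) {v' : ℚ ×ₗ WithTop ℚ}
    (hv' : IsAdjustedHeightVectorAt ε δ p (moveV p free s).F rig free v') : v' < v :=
  ((h p hp K ε δ s rig free hεδ hrf hF hclean hord hreal hqm hmon).2 v hv).2 v' hv'

/-- Unfolding the named fact at one state: Proposition 1 for the vertical move (strict). [cite: HauserWagner2014, Prop. 1 p. 200 l. 6–8] -/
theorem intricacyAt_moveV_lt (h : HauserWagner2014) (hp : p.Prime) (hεδ : AdmissibleParams ε δ)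
    (hrf : rig ≠ free) (hF : s.F ≠ 0) (hclean : deletePthPowers p s.F = s.F) (hord : (p : ℕ∞) ≤ ordZero s.F)
    (hreal : Realizes p s.F rig free) (hqm : ¬ IsQuasiMonomial s.F rig free) (hmon : 0 < height s.F rig free) :
    intricacyAt ε δ p (moveV p free s).F rig free < intricacyAt ε δ p s.F rig free :=
  (h p hp K ε δ s rig free hεδ hrf hF hclean hord hreal hqm hmon).1.2

/-- The tree's earlier named proposition `IntricacyNonincreaseStatement` (the first-component, non-strict reading of
Theorem 2 (i) with Proposition 1) follows from the named fact, for `p` prime. [cite: HauserWagner2014, Prop. 1 p. 199 l. 39 – p. 200 l. 8] -/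
theorem intricacyNonincreaseStatement_of (h : HauserWagner2014) (hp : p.Prime) (ε δ : ℚ) :
    IntricacyNonincreaseStatement ε δ p K := by
  intro s rig free hrf hεδ hF hclean hord hreal hqm hmon
  obtain ⟨⟨hT, hV⟩, -⟩ := h p hp K ε δ s rig free hεδ hrf hF hclean hord hreal hqm hmon
  exact ⟨hT, hV.le⟩

end HauserWagner2014

end Literature.AlgebraicGeometry.Resolution
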